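import Summits.HubbardSuperconductivity.HubbardSuperconductivity.Theorems.KLProgrammeKLRegimeFlowReadScaleZeroSunsetFarRowsL2

/-!
# Route `KLProgramme`, crux K3 — engine-flow child (stmt-HubbardSuperconductivity-20437), stub (C) at `n = 0`, located item #22a «(C)-SCALE0-PT2»,
# the FAR ROWS WITH THE MIDDLE PROPAGATOR BOOKED BY ITS OWN FAR DECAY («(2e)-LOW-SHELL-A2» folded into the TWO-SHELLS interface, no extra certificate)

Cell gate-hubbard-kl, seat p1 g22 (supplier; sibling of k3c5-p1's `…SunsetFarRowsL2.farRows_le_of_l2Far`, whose §1 identity and re-indexing are reused verbatim).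
In the far sunset row `Σ_{p₁ far} w_k(z_c)·|A(p₁→p₀)·A(p₀→p₁)·A(p₁→p₀)|` the middle propagator `A₂ = A(p₀→p₁)` sits at the SAME far spatial separation `−u`,
`u = x₁ − x₀`; `farRows_le_of_l2Far` books it by Gram (`‖A₂‖ ≤ 16`).  Here it is booked by the frequency sum of the far sup of the spatial kernels:
* §1 `torusFourierInv_uvSpatialSample_neg` — the scale-`0` spatial kernel is even, `TFI_ω(−u) = TFI_ω(u)` (the band `e_K` is even: `nambuXiCT_neg`);
* §2 `norm_gridCov_entry_le_sum_norm_torusFourierInv` — D7 read as a bound: `‖A((p₁,σ,+),(p₀,σ,−))‖ ≤ (1/β)·Σ_i ‖TFI_{ω_i}(x₁ − x₀)‖` (every time pair);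
* §3 **`farRows_le_of_l2Far_sup`** — `farRows_le_of_l2Far` with `16 ↦ S_far := (1/β)Σ_i Ψ i` under the extra hypothesis
  `hΨ : ∀ i, ∀ u far, ‖TFI_{ω_i}(u)‖ ≤ Ψ i`: the far row `k` is `≤ ((1/β)Σ_i Ψ i)·((1/β)Σ_i Φ i)·(4M/β)` — and, the Gram bound being gone, WITHOUT the
  hypotheses `μ ∈ klWindowC`, `klBetaMin ≤ β`, `klEngL₃ β U ≤ L` (only `0 < β`);
* §4 `norm_torusFourierInv_le_sqrt_of_l2Far` — the far sup from the far ℓ² of row `0` (one term ≤ the sum): `hΦ⁰ i ⇒ ∀ u far, ‖TFI_i(u)‖ ≤ √(Φ⁰ i)`, so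
  `Ψ i := √(Φ⁰ i)` needs NO new certificate (high shell: or directly the strip door's sup `25·(2/|ω|)e^{−κ(Rc+1)}`; low shell: `√(Dlow 0)`).
Sizes [float heuristic from p1 g21's j310440 axis table, labelled]: `S_far ≈ ω₁·√(Dlow 0) ≲ 10⁻⁴` against Gram `16` — every far row drops by `≥ 10⁵`, which is what
the `k = 2` row needs at `Rc = 2048` (its far lattice sum carries the `r³` ring weight and is `O(1)` there).  The closer twin of
`…SunsetCertRowsTwoShells.sunsetRows_of_certV3_twoShells` with `bS k ≥ row k + S_far·(high_k + ω₁·Dlow k)` is the k3c5 lineage's.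

No definitions; nothing here asserts (C), any stub of 20437, K3 or superconductivity.
References: BGM 2006 §2.3 (2.17)–(2.20), §3 (3.2) [cite: BenfattoGiulianiMastropietro2006].
-/

noncomputable section

namespace Summit.HubbardSuperconductivity.HubbardSuperconductivity.Theorems.KLRegimeSplit

set_option linter.dupNamespace false -- summit = problem name (single-conjunct summit), D-0017

open Literature.MathematicalPhysics.QuantumLattice Literature.Probability.LatticeModels Literature.Analysis.FunctionSpaces
open Summit.HubbardSuperconductivity.HubbardSuperconductivity.Theorems.DispersionFlow
open Summit.HubbardSuperconductivity.HubbardSuperconductivity.Theorems.EngineV8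
open MeasureTheory Set Finset Complex UnitAddTorus Real GrassmannAlgebra Matrix
open scoped FourierTransform Nat ENNReal NNReal

variable {L M : ℕ} [NeZero L]

/-! ## §1 The scale-`0` spatial kernel is even -/

/-- **`TFI_ω(−u) = TFI_ω(u)`**: the finite-torus Fourier inverse of the sampled spatial symbol is even (the sample `g_ω(k⃗/L) = Ψ(ω, e_K(k⃗))` is even in
`k⃗` by `nambuXiCT_neg`, and `χ_{−k}(−u) = χ_k(u)`). -/
theorem torusFourierInv_uvSpatialSample_neg (c Λ μ : ℝ) (K : TrigPolyC4v) (om : ℝ) (u : TorusSite 2 L) :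
    torusFourierInv (fun kv : TorusSite 2 L =>
        (fun y : Momentum => uvSymbolFn c Λ (frameLevel μ K ((2 * π) • y)) om) (WithLp.toLp 2 fun j => ((kv j).val : ℝ) / L)) (-u) =
      torusFourierInv (fun kv : TorusSite 2 L =>
        (fun y : Momentum => uvSymbolFn c Λ (frameLevel μ K ((2 * π) • y)) om) (WithLp.toLp 2 fun j => ((kv j).val : ℝ) / L)) u := by
  simp_rw [uvSpatialSymbol_sample]
  rw [torusFourierInv_eq_sum_torusChar, torusFourierInv_eq_sum_torusChar]
  congr 1
  refine Fintype.sum_equiv (Equiv.neg (TorusSite 2 L)) _ _ fun q => ?_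
  rw [Equiv.neg_apply, nambuXiCT_neg]
  congr 1
  simp [torusChar]

/-! ## §2 D7 as a bound: an entry is at most the frequency sum of the spatial kernels -/

/-- **`‖A((p₁,σ,+),(p₀,σ,−))‖ ≤ (1/β)·Σ_i ‖TFI_{ω_i}(x₁ − x₀)‖`** (bare frame, `0 < β`, every time pair): D7 (`gridCov_hubbardCovAboveCT_apply_eq_sum_freqTerm`,
`freqTerm_eq_torusFourierInv_one`) and `|e^{iωΔτ}| = 1`. -/
theorem norm_gridCov_entry_le_sum_norm_torusFourierInv {β : ℝ} (hβ : 0 < β) (μ : ℝ) {N : ℕ} (p₁ p₀ : GridPoint L N) (σ : Fin 2) :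
    ‖((hubbardGridSub L M β N).transpose * hubbardCovAboveCT L M β μ 0 0 klE0 * hubbardGridSub L M β N) ((p₁, σ), 0) ((p₀, σ), 1)‖ ≤
      (1 / β) * ∑ i : MatsubaraIdx M, ‖torusFourierInv (fun kv : TorusSite 2 L =>
        (fun y : Momentum => uvSymbolFn 1 klE0 (frameLevel μ 0 ((2 * π) • y)) (matsubaraFreq β M i))
          (WithLp.toLp 2 fun j => ((kv j).val : ℝ) / L)) (p₁.2 - p₀.2)‖ := by
  rw [gridCov_hubbardCovAboveCT_apply_eq_sum_freqTerm hβ μ klE0 p₁ p₀ σ, Finset.mul_sum]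
  refine (norm_sum_le _ _).trans (Finset.sum_le_sum fun i _ => ?_)
  rw [freqTerm_eq_torusFourierInv_one hβ, torusProj_valSub_eq_sub, norm_mul, norm_mul, Complex.norm_real, Real.norm_of_nonneg (by positivity),
    Complex.norm_exp]
  have hre : (I * (((matsubaraFreq β M i * (gridTime β N p₁.1 - gridTime β N p₀.1) : ℝ)) : ℂ)).re = 0 := by
    simp [Complex.mul_re]
  rw [hre, Real.exp_zero, mul_one]

/-! ## §3 The far rows with the middle propagator booked by the far sup -/

/-- **THE FAR ROWS FROM A PER-FREQUENCY WEIGHTED FAR-ℓ² FAMILY AND A PER-FREQUENCY FAR-SUP FAMILY** (bare frame; only `0 < β`): if for every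
Matsubara frequency `ω_i` the weighted far ℓ² of the torus Fourier inverse of the spatial symbol is `≤ Φ i` (as in `farRows_le_of_l2Far`) AND its far sup is
`≤ Ψ i`, then the reader's far row `k` is `≤ ((1/β)Σ_i Ψ i)·((1/β)Σ_i Φ i)·(4M/β)` — the Gram `16` of `farRows_le_of_l2Far` replaced by `S_far = (1/β)Σ_i Ψ i`. -/
theorem farRows_le_of_l2Far_sup [NeZero M] (c : SunsetCellRecordV2) {μ β : ℝ} (hβpos : 0 < β) (k : Fin 3) {Φ Ψ : MatsubaraIdx M → ℝ}
    (hΦ : ∀ i : MatsubaraIdx M, ∑ u : TorusSite 2 L,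
      (if u ≠ 0 ∧ (fun j => (u j).valMinAbs : Site 2) ∉ c.disk then
        Real.sqrt ((((u 0).valMinAbs.natAbs : ℝ)) ^ 2 + (((u 1).valMinAbs.natAbs : ℝ)) ^ 2) ^ (k : ℕ) *
          ‖torusFourierInv (fun kv : TorusSite 2 L =>
            (fun y : Momentum => uvSymbolFn 1 klE0 (frameLevel μ 0 ((2 * π) • y)) (matsubaraFreq β M i))
              (WithLp.toLp 2 fun j => ((kv j).val : ℝ) / L)) u‖ ^ 2
        else 0) ≤ Φ i)
    (hΨ : ∀ i : MatsubaraIdx M, ∀ u : TorusSite 2 L, u ≠ 0 ∧ (fun j => (u j).valMinAbs : Site 2) ∉ c.disk →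
      ‖torusFourierInv (fun kv : TorusSite 2 L =>
          (fun y : Momentum => uvSymbolFn 1 klE0 (frameLevel μ 0 ((2 * π) • y)) (matsubaraFreq β M i))
            (WithLp.toLp 2 fun j => ((kv j).val : ℝ) / L)) u‖ ≤ Ψ i)
    (hΨ0 : ∀ i, 0 ≤ Ψ i)
    (σ : Fin 2) (p₀ : GridPoint L (2 * (2 * M))) :
    ∑ p₁ : GridPoint L (2 * (2 * M)),
      (if p₁.2 ≠ p₀.2 ∧ (fun j => ((p₁.2 - p₀.2) j).valMinAbs : Site 2) ∉ c.disk then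
        Real.sqrt ((((p₁.2 - p₀.2) 0).valMinAbs.natAbs : ℝ) ^ 2 + (((p₁.2 - p₀.2) 1).valMinAbs.natAbs : ℝ) ^ 2) ^ (k : ℕ) *
          ‖contr ℂ ((hubbardGridSub L M β (2 * (2 * M))).transpose * hubbardCovAboveCT L M β μ 0 0 klE0 *
                hubbardGridSub L M β (2 * (2 * M))) (((p₁, σ), 0) : GridLeg (GridPoint L (2 * (2 * M)))) ((p₀, σ), 1) *
              (contr ℂ ((hubbardGridSub L M β (2 * (2 * M))).transpose * hubbardCovAboveCT L M β μ 0 0 klE0 *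
                hubbardGridSub L M β (2 * (2 * M))) (((p₀, σ.rev), 0) : GridLeg (GridPoint L (2 * (2 * M)))) ((p₁, σ.rev), 1) *
                contr ℂ ((hubbardGridSub L M β (2 * (2 * M))).transpose * hubbardCovAboveCT L M β μ 0 0 klE0 *
                hubbardGridSub L M β (2 * (2 * M))) (((p₁, σ.rev), 0) : GridLeg (GridPoint L (2 * (2 * M)))) ((p₀, σ.rev), 1))‖
        else 0) ≤
      (((1 / β) * ∑ i : MatsubaraIdx M, Ψ i) * ((1 / β) * ∑ i : MatsubaraIdx M, Φ i)) * (((2 * (2 * M) : ℕ) : ℝ) / β) := by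
  classical
  have hMpos : 0 < M := Nat.pos_of_ne_zero (NeZero.ne M)
  have hN : 0 < 2 * (2 * M) := by positivity
  have hNr : (0 : ℝ) < ((2 * (2 * M) : ℕ) : ℝ) := by exact_mod_cast hN
  set Cg := (hubbardGridSub L M β (2 * (2 * M))).transpose * hubbardCovAboveCT L M β μ 0 0 klE0 * hubbardGridSub L M β (2 * (2 * M)) with hCg
  -- torus Fourier inverse of the symbol at frequency `i`
  set T : MatsubaraIdx M → TorusSite 2 L → ℂ := fun i u => torusFourierInv (fun kv : TorusSite 2 L =>
      (fun y : Momentum => uvSymbolFn 1 klE0 (frameLevel μ 0 ((2 * π) • y)) (matsubaraFreq β M i))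
        (WithLp.toLp 2 fun j => ((kv j).val : ℝ) / L)) u with hT
  -- the far sup constant
  set S : ℝ := (1 / β) * ∑ i : MatsubaraIdx M, Ψ i with hS
  have hS0 : 0 ≤ S := mul_nonneg (by positivity) (Finset.sum_nonneg fun i _ => hΨ0 i)
  -- weight with the far indicator, as a function of the torus difference
  set W : TorusSite 2 L → ℝ := fun u => if u ≠ 0 ∧ (fun j => (u j).valMinAbs : Site 2) ∉ c.disk then
      Real.sqrt ((((u 0).valMinAbs.natAbs : ℝ)) ^ 2 + (((u 1).valMinAbs.natAbs : ℝ)) ^ 2) ^ (k : ℕ) else 0 with hW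
  have hW0 : ∀ u, 0 ≤ W u := fun u => by simp only [hW]; split_ifs <;> positivity
  have hΦ' : ∀ i, ∑ u : TorusSite 2 L, W u * ‖T i u‖ ^ 2 ≤ Φ i := by
    intro i
    refine le_of_eq_of_le (Finset.sum_congr rfl fun u _ => ?_) (hΦ i)
    simp only [hW, hT]
    split_ifs <;> simp
  -- the middle propagator at a far separation: `‖A(p₀ → (j₁,x))‖ ≤ S`
  have hA2 : ∀ (x : TorusSite 2 L), (x ≠ p₀.2 ∧ (fun j => ((x - p₀.2) j).valMinAbs : Site 2) ∉ c.disk) →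
      ∀ j₁ : Fin (2 * (2 * M)), ‖Cg (((p₀, σ.rev), 0) : GridLeg (GridPoint L (2 * (2 * M)))) ((((j₁, x) : GridPoint L (2 * (2 * M))), σ.rev), 1)‖ ≤ S := by
    intro x hx j₁
    have h := norm_gridCov_entry_le_sum_norm_torusFourierInv (L := L) (M := M) hβpos μ p₀ ((j₁, x) : GridPoint L (2 * (2 * M))) σ.rev
    refine h.trans ?_
    rw [hS]
    refine mul_le_mul_of_nonneg_left (Finset.sum_le_sum fun i _ => ?_) (by positivity)
    have hfar : (x - p₀.2) ≠ 0 ∧ (fun j => ((x - p₀.2) j).valMinAbs : Site 2) ∉ c.disk := ⟨sub_ne_zero.2 hx.1, hx.2⟩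
    have hev : torusFourierInv (fun kv : TorusSite 2 L =>
        (fun y : Momentum => uvSymbolFn 1 klE0 (frameLevel μ 0 ((2 * π) • y)) (matsubaraFreq β M i))
          (WithLp.toLp 2 fun j => ((kv j).val : ℝ) / L)) (p₀.2 - x) = T i (x - p₀.2) := by
      rw [show p₀.2 - x = -(x - p₀.2) by abel, torusFourierInv_uvSpatialSample_neg]
    rw [show ((p₀ : GridPoint L (2 * (2 * M))).2 - ((j₁, x) : GridPoint L (2 * (2 * M))).2) = p₀.2 - x from rfl, hev]
    exact hΨ i (x - p₀.2) hfar
  -- Step 1: sites outside, times inside; per site the time-ℓ² identity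
  rw [Fintype.sum_prod_type, Finset.sum_comm]
  have hsite : ∀ x : TorusSite 2 L,
      ∑ j₁ : Fin (2 * (2 * M)), (if ((j₁, x) : GridPoint L (2 * (2 * M))).2 ≠ p₀.2 ∧
          (fun j => ((((j₁, x) : GridPoint L (2 * (2 * M))).2 - p₀.2) j).valMinAbs : Site 2) ∉ c.disk then
        Real.sqrt ((((((j₁, x) : GridPoint L (2 * (2 * M))).2 - p₀.2) 0).valMinAbs.natAbs : ℝ) ^ 2 +
            (((((j₁, x) : GridPoint L (2 * (2 * M))).2 - p₀.2) 1).valMinAbs.natAbs : ℝ) ^ 2) ^ (k : ℕ) *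
          ‖contr ℂ Cg ((((j₁, x), σ), 0) : GridLeg (GridPoint L (2 * (2 * M)))) ((p₀, σ), 1) *
              (contr ℂ Cg (((p₀, σ.rev), 0) : GridLeg (GridPoint L (2 * (2 * M)))) (((j₁, x), σ.rev), 1) *
                contr ℂ Cg ((((j₁, x), σ.rev), 0) : GridLeg (GridPoint L (2 * (2 * M)))) ((p₀, σ.rev), 1))‖
        else 0) ≤
      W (x - p₀.2) * (S * (((2 * (2 * M) : ℕ) : ℝ) * ∑ i : MatsubaraIdx M, ‖((1 / β : ℝ) : ℂ) * T i (x - p₀.2)‖ ^ 2)) := by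
    intro x
    have hWx : W (x - p₀.2) = if x ≠ p₀.2 ∧ (fun j => ((x - p₀.2) j).valMinAbs : Site 2) ∉ c.disk then
        Real.sqrt ((((x - p₀.2) 0).valMinAbs.natAbs : ℝ) ^ 2 + (((x - p₀.2) 1).valMinAbs.natAbs : ℝ) ^ 2) ^ (k : ℕ) else 0 := by
      simp only [hW, sub_ne_zero]
    by_cases hcond : x ≠ p₀.2 ∧ (fun j => ((x - p₀.2) j).valMinAbs : Site 2) ∉ c.disk
    · simp only [hcond, and_self, if_true, ne_eq, not_false_eq_true] at hWx ⊢
      rw [hWx, ← Finset.mul_sum]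
      refine mul_le_mul_of_nonneg_left ?_ (by positivity)
      have htriple : ∀ j₁ : Fin (2 * (2 * M)),
          ‖contr ℂ Cg ((((j₁, x), σ), 0) : GridLeg (GridPoint L (2 * (2 * M)))) ((p₀, σ), 1) *
              (contr ℂ Cg (((p₀, σ.rev), 0) : GridLeg (GridPoint L (2 * (2 * M)))) (((j₁, x), σ.rev), 1) *
                contr ℂ Cg ((((j₁, x), σ.rev), 0) : GridLeg (GridPoint L (2 * (2 * M)))) ((p₀, σ.rev), 1))‖ ≤
            S * ‖Cg ((((j₁, x), σ), 0) : GridLeg (GridPoint L (2 * (2 * M)))) ((p₀, σ), 1)‖ ^ 2 := by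
        intro j₁
        rw [norm_mul, norm_mul, norm_contr_gridCov_hubbardCovAboveCT, norm_contr_gridCov_hubbardCovAboveCT, norm_contr_gridCov_hubbardCovAboveCT,
          hCg, ← gridCov_apply_spin_eq hβpos μ klE0 ((j₁, x) : GridPoint L (2 * (2 * M))) p₀ σ σ.rev]
        have h2 := hA2 x hcond j₁
        have hn1 := norm_nonneg (Cg ((((j₁, x), σ), 0) : GridLeg (GridPoint L (2 * (2 * M)))) ((p₀, σ), 1))
        have hn2 := norm_nonneg (Cg (((p₀, σ.rev), 0) : GridLeg (GridPoint L (2 * (2 * M)))) ((((j₁, x) : GridPoint L (2 * (2 * M))), σ.rev), 1))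
        rw [hCg] at h2 hn1 hn2
        nlinarith
      calc ∑ j₁ : Fin (2 * (2 * M)), ‖contr ℂ Cg ((((j₁, x), σ), 0) : GridLeg (GridPoint L (2 * (2 * M)))) ((p₀, σ), 1) *
              (contr ℂ Cg (((p₀, σ.rev), 0) : GridLeg (GridPoint L (2 * (2 * M)))) (((j₁, x), σ.rev), 1) *
                contr ℂ Cg ((((j₁, x), σ.rev), 0) : GridLeg (GridPoint L (2 * (2 * M)))) ((p₀, σ.rev), 1))‖
          ≤ ∑ j₁ : Fin (2 * (2 * M)), S * ‖Cg ((((j₁, x), σ), 0) : GridLeg (GridPoint L (2 * (2 * M)))) ((p₀, σ), 1)‖ ^ 2 :=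
            Finset.sum_le_sum fun j₁ _ => htriple j₁
        _ = S * (((2 * (2 * M) : ℕ) : ℝ) * ∑ i : MatsubaraIdx M, ‖((1 / β : ℝ) : ℂ) * T i (x - p₀.2)‖ ^ 2) := by
            rw [← Finset.mul_sum, hCg, sum_normSq_gridCov_eq_of_torusFourierInv hβpos μ p₀ x σ]
    · have hz : W (x - p₀.2) = 0 := by rw [hWx]; exact if_neg hcond
      simp only [hcond, if_false, Finset.sum_const_zero, hz, zero_mul, le_refl]
  refine (Finset.sum_le_sum fun x _ => hsite x).trans ?_
  -- Step 2: re-index `x ↦ u = x − x₀` and swap the sums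
  have hre : ∑ x : TorusSite 2 L, W (x - p₀.2) * (S * (((2 * (2 * M) : ℕ) : ℝ) * ∑ i : MatsubaraIdx M, ‖((1 / β : ℝ) : ℂ) * T i (x - p₀.2)‖ ^ 2)) =
      ∑ u : TorusSite 2 L, W u * (S * (((2 * (2 * M) : ℕ) : ℝ) * ∑ i : MatsubaraIdx M, ‖((1 / β : ℝ) : ℂ) * T i u‖ ^ 2)) :=
    Fintype.sum_equiv (Equiv.subRight p₀.2) _ _ fun x => rfl
  rw [hre]
  have hnormc : ∀ (i : MatsubaraIdx M) (u : TorusSite 2 L), ‖((1 / β : ℝ) : ℂ) * T i u‖ ^ 2 = (1 / β) ^ 2 * ‖T i u‖ ^ 2 := by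
    intro i u
    rw [norm_mul, Complex.norm_real, Real.norm_of_nonneg (by positivity), mul_pow]
  simp_rw [hnormc]
  calc ∑ u : TorusSite 2 L, W u * (S * (((2 * (2 * M) : ℕ) : ℝ) * ∑ i : MatsubaraIdx M, (1 / β) ^ 2 * ‖T i u‖ ^ 2))
      = S * ((2 * (2 * M) : ℕ) : ℝ) * (1 / β) ^ 2 * ∑ i : MatsubaraIdx M, ∑ u : TorusSite 2 L, W u * ‖T i u‖ ^ 2 := by
        rw [Finset.sum_comm]
        simp only [Finset.mul_sum]
        refine Finset.sum_congr rfl fun u _ => Finset.sum_congr rfl fun i _ => ?_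
        ring
    _ ≤ S * ((2 * (2 * M) : ℕ) : ℝ) * (1 / β) ^ 2 * ∑ i : MatsubaraIdx M, Φ i :=
        mul_le_mul_of_nonneg_left (Finset.sum_le_sum fun i _ => hΦ' i) (by positivity)
    _ = (S * ((1 / β) * ∑ i : MatsubaraIdx M, Φ i)) * (((2 * (2 * M) : ℕ) : ℝ) / β) := by
        field_simp

/-! ## §4 The far sup from the far ℓ² of row `0` -/

omit [NeZero L] in
/-- **One term is at most the sum**: if the row-`0` far ℓ² at frequency `ω` is `≤ Φ⁰`, then `‖TFI_ω(u)‖ ≤ √Φ⁰` at every far `u` — the far sup family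
`Ψ i := √(Φ⁰ i)` of `farRows_le_of_l2Far_sup` costs no new certificate. -/
theorem norm_torusFourierInv_le_sqrt_of_l2Far [NeZero L] (c : SunsetCellRecordV2) {F : TorusSite 2 L → ℂ} {Φ0 : ℝ}
    (hΦ0 : ∑ u : TorusSite 2 L, (if u ≠ 0 ∧ (fun j => (u j).valMinAbs : Site 2) ∉ c.disk then
        Real.sqrt ((((u 0).valMinAbs.natAbs : ℝ)) ^ 2 + (((u 1).valMinAbs.natAbs : ℝ)) ^ 2) ^ ((0 : Fin 3) : ℕ) * ‖F u‖ ^ 2 else 0) ≤ Φ0)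
    (u : TorusSite 2 L) (hu : u ≠ 0 ∧ (fun j => (u j).valMinAbs : Site 2) ∉ c.disk) : ‖F u‖ ≤ Real.sqrt Φ0 := by
  classical
  have hterm : ‖F u‖ ^ 2 ≤ Φ0 := by
    have h := Finset.single_le_sum (s := (Finset.univ : Finset (TorusSite 2 L))) (f := fun u : TorusSite 2 L =>
        (if u ≠ 0 ∧ (fun j => (u j).valMinAbs : Site 2) ∉ c.disk then
          Real.sqrt ((((u 0).valMinAbs.natAbs : ℝ)) ^ 2 + (((u 1).valMinAbs.natAbs : ℝ)) ^ 2) ^ ((0 : Fin 3) : ℕ) * ‖F u‖ ^ 2 else 0))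
      (fun v _ => by
        show 0 ≤ (if v ≠ 0 ∧ (fun j => (v j).valMinAbs : Site 2) ∉ c.disk then
          Real.sqrt ((((v 0).valMinAbs.natAbs : ℝ)) ^ 2 + (((v 1).valMinAbs.natAbs : ℝ)) ^ 2) ^ ((0 : Fin 3) : ℕ) * ‖F v‖ ^ 2 else 0)
        split_ifs <;> positivity)
      (Finset.mem_univ u)
    have hfu : ‖F u‖ ^ 2 = (fun u : TorusSite 2 L =>
        (if u ≠ 0 ∧ (fun j => (u j).valMinAbs : Site 2) ∉ c.disk then
          Real.sqrt ((((u 0).valMinAbs.natAbs : ℝ)) ^ 2 + (((u 1).valMinAbs.natAbs : ℝ)) ^ 2) ^ ((0 : Fin 3) : ℕ) * ‖F u‖ ^ 2 else 0)) u := by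
      simp only [hu, and_self, if_true, ne_eq, not_false_eq_true, Fin.val_zero, pow_zero, one_mul]
    exact (hfu.le.trans h).trans hΦ0
  calc ‖F u‖ = Real.sqrt (‖F u‖ ^ 2) := (Real.sqrt_sq (norm_nonneg _)).symm
    _ ≤ Real.sqrt Φ0 := Real.sqrt_le_sqrt hterm

end Summit.HubbardSuperconductivity.HubbardSuperconductivity.Theorems.KLRegimeSplit

end
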